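import Mathlib.Analysis.SpecialFunctions.Trigonometric.Inverse
import Mathlib.Analysis.SpecialFunctions.Pow.Real
import Literature.Geometry.Lorentzian.KerrSchild
import HarnessLib

/-!
# The retrograde equatorial photon orbit of Kerr in Hamiltonian form: closed-form radius,
# constants of motion, the null/Hamilton relations in the ingoing chart, and the Riccati data

(family `gr`; infrastructure for the Gaussian-beam input `SbierskiKerrTrappedGeodesicBeams` of
`Literature/Barriers/FinalStateConjecture/TrappingDerivativeLossBeams.lean`; namespace
`Literature.Geometry.Lorentzian.Kerr`; companion of `KerrPhotonOrbit.lean`, which realises the same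
orbit as an explicit curve of the Kerr–Schild chart and proves that it is a null geodesic of the
Levi-Civita connection)

Sbierski (Anal. PDE 8 (2015), §7A = arXiv:1311.2477 §3.2.1) foliates the domain of outer
communications of Kerr, `0 ≤ a ≤ M`, `M ≠ 0`, by `t* = v₊ − r` in the ingoing coordinates
`(v₊, r, θ, φ₊)` and shows that the null geodesics `γ_{r₀}` trapped on `{r = r₀}` exist exactly for
`r₀ ∈ [r_δ, r_ρ]`, the roots in `[r₊, ∞)` of `p(r) = r (r − 3M)² − 4a²M`; the two extreme values
`r_δ ≤ r_ρ` are the radii of the two *equatorial circular photon orbits* (prograde and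
retrograde), classically `r = 2M (1 + cos (⅔ arccos (∓ a/M)))` (Bardeen–Press–Teukolsky 1972;
Chandrasekhar 1983, §61). `KerrPhotonOrbitChristoffel.lean`/`KerrPhotonOrbit.lean` obtain the
retrograde radius `r_ρ ∈ [3M, 4M]` by the intermediate value theorem (`Kerr.exists_photonRadius`)
and prove that the circle `{r = r_ρ, z = 0}` traversed with frequency `−q`, `q² r_ρ³ = M`, is a
null geodesic. The Gaussian beams of the trapping barrier are built from the *cotangent* data of
this orbit — its momentum covector, Hamilton's equations, and the second derivatives of the
geodesic Hamiltonian `𝓗(x, p) = ½ g^{αβ}(x) p_α p_β` entering the Riccati equation for the phase —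
and need every constant in closed form. This file records the **retrograde** orbit
`r₀ = r_ρ ∈ [3M, 4M]` (in the exterior `{r > r₊}` for *every* `0 ≤ a ≤ M`, the extremal case
included) entirely at the level of real algebra:

* `Kerr.photonOrbitAngle M a = arccos (a/M) / 3 ∈ [0, π/6]`, `Kerr.photonOrbitSqrtRadius M a =
  2 √M cos (photonOrbitAngle M a)` (`= √r₀`), `Kerr.photonOrbitRadius M a = r₀ = 4M cos² (…)`;
  `3M ≤ r₀ ≤ 4M`, `r₊ + M ≤ r₀`, the cubic `√r₀ (r₀ − 3M) = 2a√M` (`photonOrbit_cubic`) and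
  Sbierski's `p(r₀) = r₀ (r₀ − 3M)² − 4a²M = 0` (`photonOrbit_p_eq_zero`, the hypothesis `hcubic`
  of `KerrPhotonOrbit.lean`);
* the constants of motion of the orbit, normalised to unit (negative) angular momentum: the
  frequency `Ω₀ = Kerr.photonOrbitFrequency M a = 2√M / (√r₀ (r₀ + 3M)) > 0` (`= 1/b`, `b` the
  impact parameter; `Ω₀ = 1/(3√3 M)` for `a = 0`, `1/(7M)` for `a = M`; in terms of the Kepler
  frequency `q = √(M/r₀³)` of `KerrPhotonOrbit.lean`, `Ω₀ = q/(1 − aq) = |dφ₊/dt*|`,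
  `photonOrbitFrequency_eq_div`) and the radial momentum
  `κ = Kerr.photonOrbitRadialMomentum M a = Ω₀ (r₀ + M)/(r₀ − M) > 0` of the covector
  `p = −Ω₀ dt* + κ dr − dφ₊` (in the *ingoing* chart the coordinate lines of `r` are the ingoing
  principal null geodesics, so a circular orbit has `p_r ≠ 0`);
* the inverse Kerr metric in the ingoing chart with the equatorial variable `c = cos θ`,
  `(t*, r, c, φ₊)`, as the explicit quadratic form `Kerr.ingoingInvMetricForm M a r c p`
  (`2𝓗(x, p) = g^{αβ} p_α p_β = −(1 + 2Mr/ρ²) p_t² + (4Mr/ρ²) p_t p_r + (Δ/ρ²) p_r² +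
  (2a/ρ²) p_r p_φ + ((1 − c²)/ρ²) p_c² + p_φ²/((1 − c²) ρ²)`, `ρ² = r² + a²c²`,
  `Δ = r² − 2Mr + a²`; this is `η⁻¹ − 2H ℓ♯ ⊗ ℓ♯` of the Kerr–Schild chart written in the oblate
  coordinates `X + iY = (r + ia) sin θ e^{iφ₊}`, `Z = r cos θ`, where `ℓ♯ = ∂_r − ∂_{t*}`; the
  identification with the tree's `Kerr.inverseMetric` is *not* made in this file);
* **the null and circular-geodesic relations at the orbit** (`c = 0`, `r = r₀`), as polynomial
  identities: `photonOrbit_null` (`2𝓗 = 0`), `photonOrbit_radialVelocity` (`∂𝓗/∂p_r = 0`: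
  `−2M r₀ Ω₀ + Δ₀ κ − a = 0`), `photonOrbit_radialForce` (`∂𝓗/∂r = 0`:
  `M r₀ Ω₀² + 2M r₀ Ω₀ κ + (M r₀ − a²) κ² + 2aκ − 1 = 0`), i.e. Hamilton's equations for an orbit
  of constant `r` in the equatorial plane (`θ̇ = 0`, `ṗ_θ = 0` hold by the symmetry `c ↦ −c`);
  the time component `ṫ* = ∂𝓗/∂p_t = (1 + 2M/r₀) Ω₀ + 2Mκ/r₀ > 0` (`photonOrbitTimeRate`, the
  orbit is future directed and `−g(N, γ̇) = ṫ*` is a positive constant, Sbierski §7A) and the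
  bound `a Ω₀ < 1` (`1 − a²Ω₀²` is `r₀²·∂²𝓗/∂c²`, the stability of the orbit in the polar
  direction, used for the width of the beams).

All statements are for `0 < M`, `0 ≤ a ≤ M`. Everything reduces, after the substitution
`2a√M = √r₀ (r₀ − 3M)`, to polynomial identities in `(√r₀, √M)`.

## References

* J. Sbierski, Anal. PDE 8 (2015) 1379–1420, §7A (arXiv:1311.2477, §3.2.1, pp. 26–27: the
  separated null geodesic equations (3.5)–(3.7), the polynomial `p(r) = r(r − 3m)² − 4a²m`,
  `−(N, γ̇) = ṫ`).
* J. M. Bardeen, W. H. Press, S. A. Teukolsky, Astrophys. J. 178 (1972) 347–369, §II (the photon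
  orbit `r_ph = 2M{1 + cos[⅔ cos⁻¹(∓a/M)]}`).
* S. Chandrasekhar, *The mathematical theory of black holes*, 1983, Ch. 7, §61.
* B. O'Neill, *The geometry of Kerr black holes*, 1995, Ch. 4.
-/

noncomputable section

open Real

namespace Literature.Geometry.Lorentzian.Kerr

/-! ### The retrograde equatorial photon orbit: radius -/

/-- The angle `θ_a = arccos (a/M) / 3` of the trigonometric solution of the photon-orbit cubic
(Bardeen–Press–Teukolsky 1972, §II: `r_ph = 2M{1 + cos[⅔ arccos(∓a/M)]}`, retrograde sign).
[cite: BardeenPressTeukolsky1972, §II] -/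
def photonOrbitAngle (M a : ℝ) : ℝ :=
  arccos (a / M) / 3

/-- `√r₀ = 2 √M cos θ_a`: the square root of the radius of the retrograde equatorial circular
photon orbit (Bardeen–Press–Teukolsky 1972, §II). [cite: BardeenPressTeukolsky1972, §II] -/
def photonOrbitSqrtRadius (M a : ℝ) : ℝ :=
  2 * √M * cos (photonOrbitAngle M a)

/-- **The radius `r₀ = r_ρ` of the retrograde equatorial circular photon orbit of Kerr**,
`r₀ = (2 √M cos θ_a)² = 4M cos² (arccos (a/M) / 3) = 2M (1 + cos (⅔ arccos (a/M)))`; the larger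
root in `[r₊, ∞)` of Sbierski's `p(r) = r (r − 3M)² − 4a²M` (`photonOrbit_p_eq_zero`). For `a = 0`
it is the photon sphere `3M`, for `a = M` it is `4M`. Sbierski, Anal. PDE 8 (2015), §7A
(arXiv §3.2.1); Bardeen–Press–Teukolsky 1972, §II. [cite: Sbierski2015, §7A (arXiv §3.2.1)] -/
def photonOrbitRadius (M a : ℝ) : ℝ :=
  photonOrbitSqrtRadius M a ^ 2

/-- `r₀ = 4M cos² θ_a` (Bardeen–Press–Teukolsky 1972, §II). [cite: BardeenPressTeukolsky1972, §II] -/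
theorem photonOrbitRadius_eq (M a : ℝ) (hM : 0 ≤ M) :
    photonOrbitRadius M a = 4 * M * cos (photonOrbitAngle M a) ^ 2 := by
  unfold photonOrbitRadius photonOrbitSqrtRadius
  rw [mul_pow, mul_pow, sq_sqrt hM]
  ring

/-- The Bardeen–Press–Teukolsky form `r₀ = 2M (1 + cos (⅔ arccos (a/M)))` of the retrograde
photon orbit radius (double-angle formula). [cite: BardeenPressTeukolsky1972, §II] -/
theorem photonOrbitRadius_eq_bpt (M a : ℝ) (hM : 0 ≤ M) :
    photonOrbitRadius M a = 2 * M * (1 + cos (2 / 3 * arccos (a / M))) := by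
  rw [photonOrbitRadius_eq M a hM]
  have h : 2 / 3 * arccos (a / M) = 2 * photonOrbitAngle M a := by
    unfold photonOrbitAngle; ring
  rw [h, cos_two_mul]
  ring

/-- For `0 ≤ a ≤ M`, `0 < M`: `0 ≤ θ_a ≤ π/6` (`arccos` of a number in `[0, 1]` lies in
`[0, π/2]`). [folklore] -/
theorem photonOrbitAngle_mem {M a : ℝ} (hM : 0 < M) (ha : 0 ≤ a) :
    0 ≤ photonOrbitAngle M a ∧ photonOrbitAngle M a ≤ π / 6 := by
  unfold photonOrbitAngle
  have h1 : arccos (a / M) ≤ π / 2 := arccos_le_pi_div_two.2 (div_nonneg ha hM.le)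
  exact ⟨div_nonneg (arccos_nonneg _) (by norm_num), by linarith⟩

/-- For `0 ≤ a ≤ M`, `0 < M`: `√3/2 ≤ cos θ_a ≤ 1`. [folklore] -/
theorem cos_photonOrbitAngle_mem {M a : ℝ} (hM : 0 < M) (ha : 0 ≤ a) :
    √3 / 2 ≤ cos (photonOrbitAngle M a) ∧ cos (photonOrbitAngle M a) ≤ 1 := by
  obtain ⟨h0, h1⟩ := photonOrbitAngle_mem hM ha
  refine ⟨?_, cos_le_one _⟩
  rw [← cos_pi_div_six]
  exact cos_le_cos_of_nonneg_of_le_pi h0 (by linarith [pi_pos]) h1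

/-- `√r₀ > 0` for `0 < M`, `0 ≤ a`. [folklore] -/
theorem photonOrbitSqrtRadius_pos {M a : ℝ} (hM : 0 < M) (ha : 0 ≤ a) :
    0 < photonOrbitSqrtRadius M a := by
  unfold photonOrbitSqrtRadius
  have hc := (cos_photonOrbitAngle_mem hM ha).1
  have h3 : 0 < √3 / 2 := by positivity
  have hs : 0 < √M := sqrt_pos.2 hM
  nlinarith

/-- **`3M ≤ r₀ ≤ 4M`**: the retrograde photon orbit lies between the photon sphere of
Schwarzschild (`a = 0`) and `4M` (`a = M`). Bardeen–Press–Teukolsky 1972, §II.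
[cite: BardeenPressTeukolsky1972, §II] -/
theorem photonOrbitRadius_mem {M a : ℝ} (hM : 0 < M) (ha : 0 ≤ a) :
    3 * M ≤ photonOrbitRadius M a ∧ photonOrbitRadius M a ≤ 4 * M := by
  rw [photonOrbitRadius_eq M a hM.le]
  obtain ⟨hc0, hc1⟩ := cos_photonOrbitAngle_mem hM ha
  have h3 : (√3 / 2) ^ 2 = 3 / 4 := by
    rw [div_pow, sq_sqrt (by norm_num)]; norm_num
  have hsq : 3 / 4 ≤ cos (photonOrbitAngle M a) ^ 2 := by
    rw [← h3]
    exact pow_le_pow_left₀ (by positivity) hc0 2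
  have hsq1 : cos (photonOrbitAngle M a) ^ 2 ≤ 1 := cos_sq_le_one _
  constructor <;> nlinarith

/-- `0 < r₀`. [folklore] -/
theorem photonOrbitRadius_pos {M a : ℝ} (hM : 0 < M) (ha : 0 ≤ a) :
    0 < photonOrbitRadius M a := by
  have := (photonOrbitRadius_mem hM ha).1
  linarith

/-- **The photon orbit lies in the exterior, uniformly: `r₊ + M ≤ r₀`** (`r₊ = M + √(M² − a²) ≤ 2M`
and `r₀ ≥ 3M`), for all `0 ≤ a ≤ M` including the extremal case. Sbierski, Anal. PDE 8 (2015),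
§7A ("`r_δ`, `r_ρ` are the roots of `p` in `[r₊, ∞)`"). [cite: Sbierski2015, §7A (arXiv §3.2.1)] -/
theorem rPlus_add_le_photonOrbitRadius {M a : ℝ} (hM : 0 < M) (ha : 0 ≤ a) :
    rPlus M a + M ≤ photonOrbitRadius M a := by
  have h1 := (photonOrbitRadius_mem hM ha).1
  have h2 : √(M ^ 2 - a ^ 2) ≤ M := by
    rw [sqrt_le_left hM.le]
    nlinarith
  unfold rPlus
  linarith

/-- `r₊ < r₀`: the photon orbit lies in the domain of outer communications `{r > r₊}`.
[cite: Sbierski2015, §7A (arXiv §3.2.1)] -/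
theorem rPlus_lt_photonOrbitRadius {M a : ℝ} (hM : 0 < M) (ha : 0 ≤ a) :
    rPlus M a < photonOrbitRadius M a := by
  have := rPlus_add_le_photonOrbitRadius hM ha
  linarith

/-- **The photon-orbit cubic**: `√r₀ ((√r₀)² − 3M) = 2a√M`, i.e. `√r₀ (r₀ − 3M) = 2a√M` (the
retrograde branch of `r (r − 3M)² = 4a²M`), from `cos 3θ = 4cos³θ − 3cos θ` and
`cos (arccos (a/M)) = a/M`. Bardeen–Press–Teukolsky 1972, §II; Chandrasekhar 1983, §61.
[cite: BardeenPressTeukolsky1972, §II] -/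
theorem photonOrbit_cubic {M a : ℝ} (hM : 0 < M) (ha₀ : 0 ≤ a) (haM : a ≤ M) :
    photonOrbitSqrtRadius M a * (photonOrbitSqrtRadius M a ^ 2 - 3 * M) = 2 * a * √M := by
  have hs : 0 < √M := sqrt_pos.2 hM
  have hsq : √M ^ 2 = M := sq_sqrt hM.le
  have h3 : cos (3 * photonOrbitAngle M a) = a / M := by
    have : 3 * photonOrbitAngle M a = arccos (a / M) := by unfold photonOrbitAngle; ring
    rw [this, cos_arccos]
    · have : 0 ≤ a / M := div_nonneg ha₀ hM.le
      linarith
    · exact (div_le_one hM).2 haM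
  rw [cos_three_mul] at h3
  set c := cos (photonOrbitAngle M a) with hc
  unfold photonOrbitSqrtRadius
  rw [← hc]
  have h4 : 4 * c ^ 3 - 3 * c = a / M := h3
  have h5 : M * (4 * c ^ 3 - 3 * c) = a := by
    rw [h4]; field_simp
  -- `(2√M c)((2√M c)² − 3M) = 2√M · M (4c³ − 3c)`
  have : 2 * √M * c * ((2 * √M * c) ^ 2 - 3 * M) = 2 * √M * (M * (4 * c ^ 3 - 3 * c)) := by
    rw [mul_pow, mul_pow, hsq]; ring
  rw [this, h5]
  ring

/-- **Sbierski's `p(r₀) = 0`**: `r₀ (r₀ − 3M)² = 4a²M` for the retrograde photon orbit radius.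
Sbierski, Anal. PDE 8 (2015), §7A (arXiv §3.2.1, `p(r) = r(r − 3m)² − 4a²m`).
[cite: Sbierski2015, §7A (arXiv §3.2.1)] -/
theorem photonOrbit_p_eq_zero {M a : ℝ} (hM : 0 < M) (ha₀ : 0 ≤ a) (haM : a ≤ M) :
    photonOrbitRadius M a * (photonOrbitRadius M a - 3 * M) ^ 2 - 4 * a ^ 2 * M = 0 := by
  have h := photonOrbit_cubic hM ha₀ haM
  have hsq : √M ^ 2 = M := sq_sqrt hM.le
  unfold photonOrbitRadius
  have : photonOrbitSqrtRadius M a ^ 2 * (photonOrbitSqrtRadius M a ^ 2 - 3 * M) ^ 2 =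
      (photonOrbitSqrtRadius M a * (photonOrbitSqrtRadius M a ^ 2 - 3 * M)) ^ 2 := by ring
  rw [this, h, mul_pow, mul_pow, hsq]
  ring

/-- The spin recovered from the orbit: `a = √r₀ (r₀ − 3M) / (2√M)` (the substitution that turns
every relation below into a polynomial identity in `(√r₀, √M)`). [folklore] -/
theorem eq_photonOrbit_spin {M a : ℝ} (hM : 0 < M) (ha₀ : 0 ≤ a) (haM : a ≤ M) :
    a = photonOrbitSqrtRadius M a * (photonOrbitSqrtRadius M a ^ 2 - 3 * M) / (2 * √M) := by
  have h := photonOrbit_cubic hM ha₀ haM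
  have hs : 0 < √M := sqrt_pos.2 hM
  field_simp
  linarith

/-! ### The constants of motion -/

/-- **The frequency `Ω₀ = 2√M / (√r₀ (r₀ + 3M))` of the retrograde equatorial photon orbit**
(`= |dφ₊/dt*|`-normalised energy per unit angular momentum, `E/|L| = 1/b`; equivalently, after
`2a√M = √r₀(r₀ − 3M)`, Chandrasekhar's `1/b = a (r₀ − M)/(r₀³ − 3M r₀² + a² r₀ + a² M)` with the
retrograde sign). `Ω₀ = 1/(3√3 M)` for `a = 0` and `1/(7M)` for `a = M`. Chandrasekhar 1983, §61;
Bardeen–Press–Teukolsky 1972, §II. [cite: BardeenPressTeukolsky1972, §II] -/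
def photonOrbitFrequency (M a : ℝ) : ℝ :=
  2 * √M / (photonOrbitSqrtRadius M a * (photonOrbitRadius M a + 3 * M))

/-- **The radial momentum `κ = Ω₀ (r₀ + M)/(r₀ − M)`** of the orbit's momentum covector
`p = −Ω₀ dt* + κ dr − dφ₊` in the ingoing chart `(t*, r, θ, φ₊)` (nonzero: the `r`-lines of the
ingoing chart are the ingoing principal null geodesics). Sbierski, Anal. PDE 8 (2015), §7A
(the chart); the value is fixed by `ṙ = ∂𝓗/∂p_r = 0` (`photonOrbit_radialVelocity`).
[cite: Sbierski2015, §7A (arXiv §3.2.1)] -/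
def photonOrbitRadialMomentum (M a : ℝ) : ℝ :=
  photonOrbitFrequency M a * (photonOrbitRadius M a + M) / (photonOrbitRadius M a - M)

/-- **`ṫ* = ∂𝓗/∂p_t = (1 + 2M/r₀) Ω₀ + 2Mκ/r₀`**, the rate of Sbierski's time function along the
orbit per unit angular momentum: `−g(N, γ̇) = dt*(γ̇) = ṫ*` for `N = −(dt*)♯`, "bounded away from
zero and infinity" (here a positive constant, `photonOrbitTimeRate_pos`). Sbierski, Anal. PDE 8
(2015), §7A (arXiv §3.2.1, display before Thm. 14). [cite: Sbierski2015, §7A (arXiv §3.2.1)] -/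
def photonOrbitTimeRate (M a : ℝ) : ℝ :=
  (1 + 2 * M / photonOrbitRadius M a) * photonOrbitFrequency M a +
    2 * M * photonOrbitRadialMomentum M a / photonOrbitRadius M a

/-- `Ω₀ > 0`. [folklore] -/
theorem photonOrbitFrequency_pos {M a : ℝ} (hM : 0 < M) (ha : 0 ≤ a) :
    0 < photonOrbitFrequency M a := by
  unfold photonOrbitFrequency
  have h1 := photonOrbitSqrtRadius_pos hM ha
  have h2 := photonOrbitRadius_pos hM ha
  have hs : 0 < √M := sqrt_pos.2 hM
  positivity

/-- `κ > 0`. [folklore] -/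
theorem photonOrbitRadialMomentum_pos {M a : ℝ} (hM : 0 < M) (ha : 0 ≤ a) :
    0 < photonOrbitRadialMomentum M a := by
  unfold photonOrbitRadialMomentum
  have h1 := photonOrbitFrequency_pos hM ha
  have h2 := (photonOrbitRadius_mem hM ha).1
  have h3 : 0 < photonOrbitRadius M a - M := by linarith
  have h4 : 0 < photonOrbitRadius M a + M := by linarith
  positivity

/-- `ṫ* > 0`: the orbit with momentum `p = −Ω₀ dt* + κ dr − dφ₊` is future directed.
[cite: Sbierski2015, §7A (arXiv §3.2.1)] -/
theorem photonOrbitTimeRate_pos {M a : ℝ} (hM : 0 < M) (ha : 0 ≤ a) :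
    0 < photonOrbitTimeRate M a := by
  unfold photonOrbitTimeRate
  have h1 := photonOrbitFrequency_pos hM ha
  have h2 := photonOrbitRadialMomentum_pos hM ha
  have h3 := photonOrbitRadius_pos hM ha
  positivity

/-- **`Ω₀ ≤ 1/(3√3 M)`** (the Schwarzschild value is the largest): `√r₀ ≥ √(3M)`, `r₀ + 3M ≥ 6M`.
[folklore] -/
theorem photonOrbitFrequency_le {M a : ℝ} (hM : 0 < M) (ha : 0 ≤ a) :
    photonOrbitFrequency M a ≤ 1 / (3 * √3 * M) := by
  have hs : 0 < √M := sqrt_pos.2 hM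
  have h3 : 0 < √3 := by positivity
  have hsq : √M ^ 2 = M := sq_sqrt hM.le
  have hsq3 : √3 ^ 2 = 3 := sq_sqrt (by norm_num)
  have hc := (cos_photonOrbitAngle_mem hM ha).1
  have hr := (photonOrbitRadius_mem hM ha).1
  have hspos := photonOrbitSqrtRadius_pos hM ha
  -- `√r₀ ≥ √3 √M`
  have hs0 : √3 * √M ≤ photonOrbitSqrtRadius M a := by
    unfold photonOrbitSqrtRadius; nlinarith
  have h6 : 6 * M ≤ photonOrbitRadius M a + 3 * M := by linarith
  have hden : 0 < photonOrbitSqrtRadius M a * (photonOrbitRadius M a + 3 * M) := by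
    have : 0 < photonOrbitRadius M a + 3 * M := by linarith
    positivity
  unfold photonOrbitFrequency
  rw [div_le_div_iff₀ hden (by positivity)]
  -- `2√M · 3√3 M ≤ √r₀ (r₀ + 3M)`, from `√r₀ ≥ √3√M` and `r₀ + 3M ≥ 6M`
  calc 2 * √M * (3 * √3 * M) = √3 * √M * (6 * M) := by ring
    _ ≤ photonOrbitSqrtRadius M a * (photonOrbitRadius M a + 3 * M) :=
        mul_le_mul hs0 h6 (by positivity) hspos.le
    _ = 1 * (photonOrbitSqrtRadius M a * (photonOrbitRadius M a + 3 * M)) := (one_mul _).symm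

/-- **`a Ω₀ < 1`** for `0 ≤ a ≤ M` (indeed `a Ω₀ ≤ 1/(3√3)`): the quantity `1 − a²Ω₀²`, which is
`r₀² ∂²𝓗/∂c²` at the orbit (stability in the polar direction), is positive.
[cite: Sbierski2015, §7A (arXiv §3.2.1)] -/
theorem spin_mul_photonOrbitFrequency_lt_one {M a : ℝ} (hM : 0 < M) (ha₀ : 0 ≤ a) (haM : a ≤ M) :
    a * photonOrbitFrequency M a < 1 := by
  have h1 := photonOrbitFrequency_le hM ha₀
  have h2 := photonOrbitFrequency_pos hM ha₀
  have h3 : 1 < 3 * √3 := by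
    have : (1 : ℝ) < √3 := by
      rw [show (1 : ℝ) = √1 from sqrt_one.symm]
      exact sqrt_lt_sqrt (by norm_num) (by norm_num)
    linarith
  calc a * photonOrbitFrequency M a ≤ M * (1 / (3 * √3 * M)) := mul_le_mul haM h1 h2.le hM.le
    _ = 1 / (3 * √3) := by field_simp
    _ < 1 := by rw [div_lt_one (by positivity)]; exact h3

/-- **`Ω₀ = q/(1 − aq)` for the Kepler frequency `q = √(M/r₀³)`** of `KerrPhotonOrbit.lean`
(there the orbit is `s ↦ ((1 − aq)s, ρ cos(qs), −ρ sin(qs), 0)`, so `|dφ₊/dt*| = q/(1 − aq)`):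
the two parametrisations of the retrograde photon orbit agree. Bardeen–Press–Teukolsky 1972,
§II. [cite: BardeenPressTeukolsky1972, §II] -/
theorem photonOrbitFrequency_eq_div {M a : ℝ} (hM : 0 < M) (ha₀ : 0 ≤ a) (haM : a ≤ M) :
    photonOrbitFrequency M a =
      √(M / photonOrbitRadius M a ^ 3) / (1 - a * √(M / photonOrbitRadius M a ^ 3)) := by
  have hcubic := photonOrbit_cubic hM ha₀ haM
  have hspos := photonOrbitSqrtRadius_pos hM ha₀
  have h3M := (photonOrbitRadius_mem hM ha₀).1
  have hmpos : 0 < √M := sqrt_pos.2 hM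
  have hmsq : √M ^ 2 = M := sq_sqrt hM.le
  -- `q = √M / √r₀³`
  have hq : √(M / photonOrbitRadius M a ^ 3) = √M / photonOrbitSqrtRadius M a ^ 3 := by
    rw [sqrt_div' _ (pow_pos (photonOrbitRadius_pos hM ha₀) 3).le, photonOrbitRadius,
      show (photonOrbitSqrtRadius M a ^ 2) ^ 3 = (photonOrbitSqrtRadius M a ^ 3) ^ 2 by ring,
      sqrt_sq (pow_pos hspos 3).le]
  rw [hq]
  unfold photonOrbitFrequency photonOrbitRadius at *
  generalize hs : photonOrbitSqrtRadius M a = s at *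
  generalize hm : √M = m at *
  subst hmsq
  have ha : a = s * (s ^ 2 - 3 * m ^ 2) / (2 * m) := by
    field_simp
    linarith
  subst ha
  have h2 : 0 < s ^ 2 + 3 * m ^ 2 := by positivity
  have h4 : 1 - s * (s ^ 2 - 3 * m ^ 2) / (2 * m) * (m / s ^ 3) =
      (s ^ 2 + 3 * m ^ 2) / (2 * s ^ 2) := by
    field_simp
    ring
  rw [h4]
  field_simp

/-! ### The inverse metric in the ingoing chart and the orbit relations -/

/-- **The inverse Kerr metric in the ingoing chart `(t*, r, c = cos θ, φ₊)`** as a quadratic form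
in the momentum components `p = (p_t, p_r, p_c, p_φ)`:
`2𝓗 = g^{αβ} p_α p_β = −(1 + 2Mr/ρ²) p_t² + (4Mr/ρ²) p_t p_r + (Δ/ρ²) p_r² + (2a/ρ²) p_r p_φ
 + ((1 − c²)/ρ²) p_c² + p_φ² / ((1 − c²) ρ²)`, `ρ² = r² + a²c²`, `Δ = r² − 2Mr + a²`.
This is Sbierski's ingoing form of the metric (Anal. PDE 8 (2015), §7A, the display for `g` in
`(v₊, r, θ, φ₊)`) inverted and rewritten with `t* = v₊ − r`, `c = cos θ`; equivalently the
Kerr–Schild `g⁻¹ = η⁻¹ − 2H ℓ♯ ⊗ ℓ♯`, `H = Mr/ρ²`, `ℓ♯ = ∂_r − ∂_{t*}`, in the oblate coordinates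
`X + iY = (r + ia) sin θ e^{iφ₊}`, `Z = r cos θ` of the Kerr–Schild chart. Junk values at `ρ = 0`
and `c = ±1` (division by zero). [cite: Sbierski2015, §7A (arXiv §3.2.1)] -/
def ingoingInvMetricForm (M a r c : ℝ) (p : Fin 4 → ℝ) : ℝ :=
  (-(1 + 2 * M * r / (r ^ 2 + a ^ 2 * c ^ 2))) * p 0 ^ 2
    + (4 * M * r / (r ^ 2 + a ^ 2 * c ^ 2)) * p 0 * p 1
    + ((r ^ 2 - 2 * M * r + a ^ 2) / (r ^ 2 + a ^ 2 * c ^ 2)) * p 1 ^ 2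
    + (2 * a / (r ^ 2 + a ^ 2 * c ^ 2)) * p 1 * p 3
    + ((1 - c ^ 2) / (r ^ 2 + a ^ 2 * c ^ 2)) * p 2 ^ 2
    + p 3 ^ 2 / ((1 - c ^ 2) * (r ^ 2 + a ^ 2 * c ^ 2))

/-- **The momentum of the retrograde photon orbit** in the ingoing chart, per unit angular
momentum: `p = (p_t, p_r, p_c, p_φ) = (−Ω₀, κ, 0, −1)`. [cite: Sbierski2015, §7A (arXiv §3.2.1)] -/
def photonOrbitMomentum (M a : ℝ) : Fin 4 → ℝ :=
  ![-photonOrbitFrequency M a, photonOrbitRadialMomentum M a, 0, -1]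


/-- Unfolding of the momentum components. [folklore] -/
@[simp] theorem photonOrbitMomentum_zero (M a : ℝ) :
    photonOrbitMomentum M a 0 = -photonOrbitFrequency M a := rfl

/-- Unfolding of the momentum components. [folklore] -/
@[simp] theorem photonOrbitMomentum_one (M a : ℝ) :
    photonOrbitMomentum M a 1 = photonOrbitRadialMomentum M a := rfl

/-- Unfolding of the momentum components. [folklore] -/
@[simp] theorem photonOrbitMomentum_two (M a : ℝ) : photonOrbitMomentum M a 2 = 0 := rfl

/-- Unfolding of the momentum components. [folklore] -/
@[simp] theorem photonOrbitMomentum_three (M a : ℝ) : photonOrbitMomentum M a 3 = -1 := rfl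

/-- **`ṙ = 0` (Hamilton's equation `∂𝓗/∂p_r = 0` at the orbit): `−2M r₀ Ω₀ + Δ₀ κ − a = 0`**,
`Δ₀ = r₀² − 2M r₀ + a²`; this is `(r₀²/2) ∂(2𝓗)/∂p_r` at `(r, c, p) = (r₀, 0, p_orbit)` and it is
what fixes `κ`. Sbierski, Anal. PDE 8 (2015), §7A (arXiv §3.2.1, (3.6): a double zero of `R`
is an orbit of constant `r`). [cite: Sbierski2015, §7A (arXiv §3.2.1)] -/
theorem photonOrbit_radialVelocity {M a : ℝ} (hM : 0 < M) (ha₀ : 0 ≤ a) (haM : a ≤ M) :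
    -2 * M * photonOrbitRadius M a * photonOrbitFrequency M a
      + (photonOrbitRadius M a ^ 2 - 2 * M * photonOrbitRadius M a + a ^ 2) *
          photonOrbitRadialMomentum M a - a = 0 := by
  have hcubic := photonOrbit_cubic hM ha₀ haM
  have hspos := photonOrbitSqrtRadius_pos hM ha₀
  have h3M := (photonOrbitRadius_mem hM ha₀).1
  have hmpos : 0 < √M := sqrt_pos.2 hM
  have hmsq : √M ^ 2 = M := sq_sqrt hM.le
  unfold photonOrbitRadialMomentum photonOrbitFrequency photonOrbitRadius at *
  generalize hs : photonOrbitSqrtRadius M a = s at *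
  generalize hm : √M = m at *
  subst hmsq
  have ha : a = s * (s ^ 2 - 3 * m ^ 2) / (2 * m) := by
    field_simp
    linarith
  subst ha
  have h1 : 0 < s ^ 2 - m ^ 2 := by nlinarith
  have h2 : 0 < s ^ 2 + 3 * m ^ 2 := by positivity
  field_simp
  ring

/-- **Nullity of the orbit: `2𝓗(r₀, 0; p) = 0`** for `p = (−Ω₀, κ, 0, −1)`, i.e.
`−(r₀² + 2M r₀) Ω₀² − 4M r₀ Ω₀ κ + Δ₀ κ² − 2aκ + 1 = 0`. Sbierski, Anal. PDE 8 (2015), §7A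
(arXiv §3.2.1). [cite: Sbierski2015, §7A (arXiv §3.2.1)] -/
theorem photonOrbit_null {M a : ℝ} (hM : 0 < M) (ha₀ : 0 ≤ a) (haM : a ≤ M) :
    ingoingInvMetricForm M a (photonOrbitRadius M a) 0 (photonOrbitMomentum M a) = 0 := by
  have hcubic := photonOrbit_cubic hM ha₀ haM
  have hspos := photonOrbitSqrtRadius_pos hM ha₀
  have h3M := (photonOrbitRadius_mem hM ha₀).1
  have hmpos : 0 < √M := sqrt_pos.2 hM
  have hmsq : √M ^ 2 = M := sq_sqrt hM.le
  simp only [ingoingInvMetricForm, photonOrbitMomentum_zero, photonOrbitMomentum_one,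
    photonOrbitMomentum_two, photonOrbitMomentum_three]
  unfold photonOrbitRadialMomentum photonOrbitFrequency photonOrbitRadius at *
  generalize hs : photonOrbitSqrtRadius M a = s at *
  generalize hm : √M = m at *
  subst hmsq
  have ha : a = s * (s ^ 2 - 3 * m ^ 2) / (2 * m) := by
    field_simp
    linarith
  subst ha
  have h1 : 0 < s ^ 2 - m ^ 2 := by nlinarith
  have h2 : 0 < s ^ 2 + 3 * m ^ 2 := by positivity
  field_simp
  ring

/-- **`ṗ_r = 0` (Hamilton's equation `∂𝓗/∂r = 0` at the orbit):
`M r₀ Ω₀² + 2M r₀ Ω₀ κ + (M r₀ − a²) κ² + 2aκ − 1 = 0`**; this is `(r₀³/2) ∂(2𝓗)/∂r` at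
`(r₀, 0, p_orbit)` (`∂𝓗/∂c = 0` there by the symmetry `c ↦ −c`). Together with
`photonOrbit_null` and `photonOrbit_radialVelocity` it says that `{r = r₀, c = 0}` carries a null
geodesic with momentum `p` — the double zero of `R(r)`. Sbierski, Anal. PDE 8 (2015), §7A
(arXiv §3.2.1). [cite: Sbierski2015, §7A (arXiv §3.2.1)] -/
theorem photonOrbit_radialForce {M a : ℝ} (hM : 0 < M) (ha₀ : 0 ≤ a) (haM : a ≤ M) :
    M * photonOrbitRadius M a * photonOrbitFrequency M a ^ 2
      + 2 * M * photonOrbitRadius M a * photonOrbitFrequency M a * photonOrbitRadialMomentum M a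
      + (M * photonOrbitRadius M a - a ^ 2) * photonOrbitRadialMomentum M a ^ 2
      + 2 * a * photonOrbitRadialMomentum M a - 1 = 0 := by
  have hcubic := photonOrbit_cubic hM ha₀ haM
  have hspos := photonOrbitSqrtRadius_pos hM ha₀
  have h3M := (photonOrbitRadius_mem hM ha₀).1
  have hmpos : 0 < √M := sqrt_pos.2 hM
  have hmsq : √M ^ 2 = M := sq_sqrt hM.le
  unfold photonOrbitRadialMomentum photonOrbitFrequency photonOrbitRadius at *
  generalize hs : photonOrbitSqrtRadius M a = s at *
  generalize hm : √M = m at *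
  subst hmsq
  have ha : a = s * (s ^ 2 - 3 * m ^ 2) / (2 * m) := by
    field_simp
    linarith
  subst ha
  have h1 : 0 < s ^ 2 - m ^ 2 := by nlinarith
  have h2 : 0 < s ^ 2 + 3 * m ^ 2 := by positivity
  field_simp
  ring

/-- **The rate `ṫ*` is `∂𝓗/∂p_t` at the orbit**: `(1 + 2M/r₀) Ω₀ + 2Mκ/r₀ =
½ ∂(2𝓗)/∂p_t (r₀, 0; p)` written out (`g^{tt} p_t + g^{tr} p_r` with `p_t = −Ω₀`, `p_r = κ`).
[cite: Sbierski2015, §7A (arXiv §3.2.1)] -/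
theorem photonOrbitTimeRate_eq {M a : ℝ} (hM : 0 < M) (ha : 0 ≤ a) :
    photonOrbitTimeRate M a =
      (-(1 + 2 * M * photonOrbitRadius M a / (photonOrbitRadius M a ^ 2 + a ^ 2 * 0 ^ 2))) *
          (-photonOrbitFrequency M a) +
        (2 * M * photonOrbitRadius M a / (photonOrbitRadius M a ^ 2 + a ^ 2 * 0 ^ 2)) *
          photonOrbitRadialMomentum M a := by
  have hr := photonOrbitRadius_pos hM ha
  unfold photonOrbitTimeRate
  field_simp
  ring

/-! ### Second-order data at the orbit: the coefficients of the Riccati equation -/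

/-- **`α₀ = ∂²𝓗/∂r²` at the orbit** (`c = 0`, `r = r₀`, `p = (−Ω₀, κ, 0, −1)`), written out:
`α₀ = −(2M/r₀³) Ω₀² − (4M/r₀³) Ω₀ κ + (−2M/r₀³ + 3a²/r₀⁴) κ² − 6aκ/r₀⁴ + 3/r₀⁴`; the matrix `A`
of Sbierski's Riccati equation (Anal. PDE 8 (2015), §3, (2.20) of the arXiv text:
`0 = A + BM + MBᵀ + MCM + Ṁ`, `A_{κρ} = ∂²H/∂x^κ∂x^ρ`) in the radial direction.
[cite: Sbierski2015, §3 (arXiv §2.2, (2.20))] -/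
def photonOrbitRiccatiA (M a : ℝ) : ℝ :=
  -(2 * M / photonOrbitRadius M a ^ 3) * photonOrbitFrequency M a ^ 2
    - (4 * M / photonOrbitRadius M a ^ 3) * photonOrbitFrequency M a *
        photonOrbitRadialMomentum M a
    + (-(2 * M / photonOrbitRadius M a ^ 3) + 3 * a ^ 2 / photonOrbitRadius M a ^ 4) *
        photonOrbitRadialMomentum M a ^ 2
    - 6 * a * photonOrbitRadialMomentum M a / photonOrbitRadius M a ^ 4
    + 3 / photonOrbitRadius M a ^ 4

/-- **`β₀ = ∂²𝓗/∂r∂p_r` at the orbit**: `β₀ = 2MΩ₀/r₀² + (2M r₀ − 2a²) κ/r₀³ + 2a/r₀³`; the matrix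
`B` of the Riccati equation in the radial direction. [cite: Sbierski2015, §3 (arXiv §2.2, (2.20))] -/
def photonOrbitRiccatiB (M a : ℝ) : ℝ :=
  2 * M * photonOrbitFrequency M a / photonOrbitRadius M a ^ 2
    + (2 * M * photonOrbitRadius M a - 2 * a ^ 2) * photonOrbitRadialMomentum M a /
        photonOrbitRadius M a ^ 3
    + 2 * a / photonOrbitRadius M a ^ 3

/-- **`γ₀ = ∂²𝓗/∂p_r² = g^{rr} = Δ₀/r₀²` at the orbit**; the matrix `C` of the Riccati equation
in the radial direction. [cite: Sbierski2015, §3 (arXiv §2.2, (2.20))] -/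
def photonOrbitRiccatiC (M a : ℝ) : ℝ :=
  (photonOrbitRadius M a ^ 2 - 2 * M * photonOrbitRadius M a + a ^ 2) / photonOrbitRadius M a ^ 2

/-- `γ₀ > 0` (`Δ₀ > 0` outside the horizon; indeed `r₀ ≥ 3M`). [folklore] -/
theorem photonOrbitRiccatiC_pos {M a : ℝ} (hM : 0 < M) (ha : 0 ≤ a) :
    0 < photonOrbitRiccatiC M a := by
  unfold photonOrbitRiccatiC
  have h := (photonOrbitRadius_mem hM ha).1
  have hr := photonOrbitRadius_pos hM ha
  apply div_pos _ (by positivity)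
  nlinarith [sq_nonneg a]

/-- **The discriminant of the radial Riccati equation: `β₀² − α₀ γ₀ = (1 − a²Ω₀²)/r₀⁴ > 0`**
(hyperbolicity = instability of the photon orbit in the radial direction; `√(β₀² − α₀γ₀)/ṫ*` is
its Lyapunov exponent in `t*`, `1/(3√3 M)` for `a = 0`). A polynomial identity in `(√r₀, √M)`
after `2a√M = √r₀ (r₀ − 3M)`. [cite: Sbierski2015, §3 (arXiv §2.2, (2.20)) with §7A] -/
theorem photonOrbit_riccatiDiscr {M a : ℝ} (hM : 0 < M) (ha₀ : 0 ≤ a) (haM : a ≤ M) :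
    photonOrbitRiccatiB M a ^ 2 - photonOrbitRiccatiA M a * photonOrbitRiccatiC M a =
      (1 - a ^ 2 * photonOrbitFrequency M a ^ 2) / photonOrbitRadius M a ^ 4 := by
  have hcubic := photonOrbit_cubic hM ha₀ haM
  have hspos := photonOrbitSqrtRadius_pos hM ha₀
  have h3M := (photonOrbitRadius_mem hM ha₀).1
  have hmpos : 0 < √M := sqrt_pos.2 hM
  have hmsq : √M ^ 2 = M := sq_sqrt hM.le
  unfold photonOrbitRiccatiA photonOrbitRiccatiB photonOrbitRiccatiC photonOrbitRadialMomentum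
    photonOrbitFrequency photonOrbitRadius at *
  generalize hs : photonOrbitSqrtRadius M a = s at *
  generalize hm : √M = m at *
  subst hmsq
  have ha : a = s * (s ^ 2 - 3 * m ^ 2) / (2 * m) := by
    field_simp
    linarith
  subst ha
  have h1 : 0 < s ^ 2 - m ^ 2 := by nlinarith
  have h2 : 0 < s ^ 2 + 3 * m ^ 2 := by positivity
  field_simp
  ring

/-- The discriminant is positive. [cite: Sbierski2015, §3 (arXiv §2.2, (2.20)) with §7A] -/
theorem photonOrbit_riccatiDiscr_pos {M a : ℝ} (hM : 0 < M) (ha₀ : 0 ≤ a) (haM : a ≤ M) :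
    0 < photonOrbitRiccatiB M a ^ 2 - photonOrbitRiccatiA M a * photonOrbitRiccatiC M a := by
  rw [photonOrbit_riccatiDiscr hM ha₀ haM]
  have h1 := spin_mul_photonOrbitFrequency_lt_one hM ha₀ haM
  have h2 : 0 ≤ a * photonOrbitFrequency M a :=
    mul_nonneg ha₀ (photonOrbitFrequency_pos hM ha₀).le
  have hr := photonOrbitRadius_pos hM ha₀
  apply div_pos _ (by positivity)
  nlinarith

/-- **`∂²𝓗/∂c²` at the orbit equals `(1 − a²Ω₀²)/r₀²`** (positivity = stability of the orbit in
the polar direction; it fixes the polar width `β = √(1 − a²Ω₀²)` of the Gaussian beams through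
the `(θ, θ)` component of the Riccati equation). Written out, `∂²𝓗/∂c²` at `c = 0` with `p`
fixed is `{−a²[−2M r₀ Ω₀² − 4M r₀ Ω₀ κ + Δ₀ κ² − 2aκ] + (r₀² − a²)}/r₀⁴`.
[cite: Sbierski2015, §3 (arXiv §2.2, (2.20)) with §7A] -/
theorem photonOrbit_polarHessian {M a : ℝ} (hM : 0 < M) (ha₀ : 0 ≤ a) (haM : a ≤ M) :
    (-a ^ 2 * (-2 * M * photonOrbitRadius M a * photonOrbitFrequency M a ^ 2
        - 4 * M * photonOrbitRadius M a * photonOrbitFrequency M a * photonOrbitRadialMomentum M a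
        + (photonOrbitRadius M a ^ 2 - 2 * M * photonOrbitRadius M a + a ^ 2) *
            photonOrbitRadialMomentum M a ^ 2
        - 2 * a * photonOrbitRadialMomentum M a)
      + (photonOrbitRadius M a ^ 2 - a ^ 2)) / photonOrbitRadius M a ^ 4 =
      (1 - a ^ 2 * photonOrbitFrequency M a ^ 2) / photonOrbitRadius M a ^ 2 := by
  have hcubic := photonOrbit_cubic hM ha₀ haM
  have hspos := photonOrbitSqrtRadius_pos hM ha₀
  have h3M := (photonOrbitRadius_mem hM ha₀).1
  have hmpos : 0 < √M := sqrt_pos.2 hM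
  have hmsq : √M ^ 2 = M := sq_sqrt hM.le
  unfold photonOrbitRadialMomentum photonOrbitFrequency photonOrbitRadius at *
  generalize hs : photonOrbitSqrtRadius M a = s at *
  generalize hm : √M = m at *
  subst hmsq
  have ha : a = s * (s ^ 2 - 3 * m ^ 2) / (2 * m) := by
    field_simp
    linarith
  subst ha
  have h1 : 0 < s ^ 2 - m ^ 2 := by nlinarith
  have h2 : 0 < s ^ 2 + 3 * m ^ 2 := by positivity
  field_simp
  ring

end Literature.Geometry.Lorentzian.Kerr

end
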